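import Literature.MathematicalPhysics.QuantumLattice.SpinTorusLimitStates
import Literature.MathematicalPhysics.QuantumLattice.XXZGroundStateFiniteVolumeFieldBound
import HarnessLib

/-!
# Koma–Tasaki 1993 §1 / Corollary 1.1 and Dyson–Lieb–Simon 1978 IN INFINITE VOLUME: the
# infinitesimal-field states of the Heisenberg / XXZ antiferromagnet on `ℤ^d` and their spontaneous
# staggered magnetisation

T. Koma, H. Tasaki, *Symmetry breaking in Heisenberg antiferromagnets*, Commun. Math. Phys. **158** (1993)
191–214 (`KomaTasaki1993`, held as `paper:doi-10-1007-bf02097237`), §1.  For the spin-`S` Heisenberg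
antiferromagnet `H_Λ = Σ_{⟨x,y⟩} 𝐒_x·𝐒_y` on the periodic box `Λ = (ℤ/Lℤ)^d`, `L` even, with order operator
`O_Λ = Σ_x (-1)^{x_1+⋯+x_d} S^{(1)}_x` ((1.2)), Dyson–Lieb–Simon / Kennedy–Lieb–Shastry prove the long-range
order `σ² = lim_Λ ⟨(O_Λ/|Λ|)²⟩_Λ^β > 0` ((1.2)–(1.4)); KT93 then consider (p. 193)

> "a standard way to get an infinite volume state with explicit symmetry breaking is to apply an
> infinitesimally small symmetry breaking field …
> `ω̃(⋯) := lim_{B↓0} lim_{L↑∞} Tr[(⋯) e^{-β(H_Λ - BO_Λ)}] / Tr[e^{-β(H_Λ - BO_Λ)}]`          (1.8)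
> … the spontaneous staggered magnetization
> `m_s := lim_{B↓0} lim_{L↑∞} ω̃((-1)^{x}S^{(1)}_x) = lim_{B↓0} lim_{L↑∞} L^{-d} Tr[O_Λ e^{-β(H_Λ-BO_Λ)}]/Tr[⋯]` (1.9)
> (The equality in (1.9) follows from the translation invariance.) …
> **Corollary 1.1.** In the isotropic Heisenberg antiferromagnet (1.1), the long range order parameter (1.2)
> and the spontaneous staggered magnetization (1.9) satisfy `m_s ≥ √3 σ` (1.10) for any inverse temperature
> `β`. … Since the bound (1.10) is valid for any temperature, it applies to the ground state obtained by
> letting `β → ∞` after the infinite volume limit. We also directly treat the ground states in a finite volume"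

The tree PROVES every finite-volume ingredient — `dyson_lieb_simon_holds`, `kennedy_lieb_shastry_ground_holds`,
and the Koma–Tasaki transport in the `∀ B > 0, ∀ ε > 0, eventually in L` form freed of KT93's hypothesis i):
`XXZKT.heisenbergAF_thermal_spontaneousStaggeredMagnetisation` (`d ≥ 3`, `β ≥ β₀`:
`√3σ - ε ≤ |Λ|⁻¹⟨O_Λ⟩_{β, H_Λ - BO_Λ}`), `XXZKT.xxzAF_thermal_spontaneousStaggeredMagnetisation` (`0 ≤ Δ ≤ 1`, `√2σ`),
`XXZKT.xxzAF_thermal_spontaneousNeelMagnetisation` (`Δ ≥ 1`, Ising side, `σ`), and at `T = 0`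
`XXZKT.heisenbergAF_ground_spontaneousStaggeredMagnetisation_groundStateFunctional` (`d ≥ 2`, `(d,S) ≠ (2,½)`),
`…xxzAF_ground_…`, `…xxzAF_ground_spontaneousNeelMagnetisation_groundStateFunctional` — but (1.8)/(1.9) had no
infinite-volume reading for quantum spins (the spin `InfVolState` only had box limits).  With the torus-limit
states of `SpinTorusLimitStates.lean` this file gives that reading, for the spin-`n/2` XXZ antiferromagnet
`H = J Σ_{⟨x,y⟩}(SˣSˣ + SʸSʸ + ΔSᶻSᶻ)` (`J > 0`) with staggered source `-B·O^α`, `O^α = Σ_x(-1)^xS^α_x`, on the even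
tori `(ℤ/(2k+2)ℤ)^d`:

## Contents (everything PROVED; definitions = the states of (1.8), no named fact)

* §1 Lattice symmetries of the sourced torus Hamiltonian `K = H - B·O^α` (finite volume): covariance of the XXZ
  Hamiltonian under graph isomorphisms and torus translations (`reindexOp_xxzHamiltonian`,
  `reindexOp_torusAff_xxzHamiltonian`), multiplicativity of the Néel sign on the even torus
  (`stagSign_torusParityExp_add`) and its agreement with `latticeStagger` under `x ↦ x mod L`
  (`stagSign_torusParityExp_proj`), `reindexOp_addRight_stagSpin` (a translation multiplies `O^α` by its sign),
  the global spin flip of one component fixing `H` (`exists_siteSpin_flip`, KT93 (2.3)/(2.5)), and the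
  **sublattice symmetry of symmetric states**: for every state `ρ` of the torus invariant under the unitaries
  commuting with `K` — the Gibbs states and the tracial ground state of `K` —
  `(-1)^y ρ(S^α_y) = |Λ|⁻¹ ρ(O^α)` at EVERY site `y` (`stagSign_mul_apply_siteSpin_eq_avg`; "the equality in (1.9)").
* §2 The states of (1.8): `IsSourcedLimit ρ B ω` (generic: `ω` is a torus limit, along even sides
  `2κ_j + 2 → ∞`, of the finite-volume states `ρ k B` of `K`), specialised to
  `IsSourcedThermalLimit d n J Δ α β B ω` (Gibbs states `⟨·⟩_{β, H-BO}`, the inner limit of (1.8)) and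
  `IsSourcedGroundStateLimit d n J Δ α B ω` (tracial ground states of `H - BO`, "the ground states in a finite
  volume"); `IsInfinitesimalFieldThermalState d n J Δ α β ω` / `IsInfinitesimalFieldGroundState d n J Δ α ω` — the
  outer limit `B ↓ 0` of (1.8): `ω` is a pointwise (weak-⋆) limit of sourced limit states at fields `B_m > 0`,
  `B_m → 0`.  EXISTENCE of all four kinds of states (`exists_isSourcedThermalLimit`, …, by the compactness
  theorems of `SpinTorusLimitStates.lean`), invariance under the EVEN translations of `ℤ^d`
  (`IsSourcedLimit.shift_eq`, …), and the one-point dictionary (1.9): along the defining tori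
  `|Λ_j|⁻¹ Re⟨O^α⟩ → (-1)^x Re ω(S^α_x)` for every site `x` (`tendsto_avg_stagSpin_of_isTorusLimitOf`), so the
  staggered one-point function `(-1)^x Re ω(S^α_x)` is SITE-INDEPENDENT (`IsSourcedLimit.stagMagnetisation_eq`) —
  KT93's `m_s` read on the state.
* §3 THE FLOORS (KT93 Corollary 1.1 (1.10) with DLS/KLS, in infinite volume):
  `heisenbergAF_infiniteVolume_spontaneousStaggeredMagnetisation` — `d ≥ 3`, `S = n/2 ≥ ½`, `J > 0`, `Δ = 1`:
  there is `β₀ > 0` such that for every `β ≥ β₀` there is `σ > 0` (the DLS/KLS long-range order parameter) with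
  `√3 σ ≤ (-1)^x Re ω(Sˣ_x)` at EVERY site `x ∈ ℤ^d`, for EVERY sourced thermal limit state at any `B > 0` and
  EVERY infinitesimal-field thermal state `ω̃`; `xxzAF_infiniteVolume_…` (`0 ≤ Δ ≤ 1`, `√2σ`),
  `xxzAF_infiniteVolume_spontaneousNeelMagnetisation` (`Δ ≥ 1`, order along `z`, `σ`); and the `T = 0`
  versions `heisenbergAF_infiniteVolume_groundState_…` (`d ≥ 2`, `(d, S) ≠ (2, ½)`), `xxzAF_…`, Ising side.

Proof of the one-point dictionary (KT93 "follows from the translation invariance", made explicit): on the even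
torus the unitary `U_v = P_v` (translation by `v`, `v` even) or `U_v = P_v W` (`v` odd, `W` the global `π`-rotation
flipping the `α`-component, KT93 (2.5)) commutes with `K = H - BO^α` and maps `S^α_y ↦ ± S^α_{y+v}`; a
`U_v`-invariant state therefore has `(-1)^{y+v}ρ(S^α_{y+v}) = (-1)^yρ(S^α_y)`, and averaging over `v` gives
`|Λ|⁻¹ρ(O^α)`.  Gibbs states and the tracial ground state are invariant under every unitary commuting with `K`
(tree `Matrix.gibbsState_conjTranspose_mul_mul`, `Matrix.groundStateFunctional_conj_of_commute`).

WHAT THIS IS NOT: not a statement about the Hubbard model; no claim that the limit states are KMS states /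
infinite-volume ground states in the sense of the local (Bratteli–Robinson) criteria, nor that they are pure
(KT93: "It is likely that the state ω̃ is pure, but there is no proof"); the limits in (1.8) are realised along
subsequences (compactness), exactly as much as is proved.

## References
* [KomaTasaki1993] T. Koma, H. Tasaki, Commun. Math. Phys. **158** (1993) 191–214: §1 (1.1)–(1.10),
  Corollary 1.1; §2 (2.3), (2.5) (the global flip `U_Λ`); Theorem 2.1, Corollary 2.2.
* [DLS1978] F. J. Dyson, E. H. Lieb, B. Simon, J. Stat. Phys. **18** (1978) 335–383, §1 and Thm. 5.2 (Néel
  order, `d ≥ 3`, `S ≥ 1`).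
* [KennedyLiebShastryJSP1988] T. Kennedy, E. H. Lieb, B. S. Shastry, J. Stat. Phys. **53** (1988) 1019–1030
  (`d = 3`, `S = ½`; ground states).
* [BratteliRobinsonII1997] O. Bratteli, D. W. Robinson, *OAQSM 2*, §6.2.1–6.2.2 (quasi-local algebra, periodic
  boundary conditions, thermodynamic limit of Gibbs states).
* [Tasaki2020] H. Tasaki, *Physics and Mathematics of Quantum Many-Body Systems*, §2.2 (2.2.12) (global
  rotations), §4.4 (DLS/KLS and the infinitesimal-field order parameter).
-/

noncomputable section

namespace Literature.MathematicalPhysics.QuantumLattice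

namespace XXZKT

open Matrix Finset _root_.Filter Literature.Probability.LatticeModels
  Literature.MathematicalPhysics.QuantumLattice.SpinOperators
open scoped _root_.Topology ComplexOrder

/-! ### §1a Covariance of the XXZ Hamiltonian and the global flip of one spin component -/

section Graph

variable {V W : Type*} [Fintype V] [DecidableEq V] [Fintype W] [DecidableEq W] (n : ℕ)

/-- **Covariance of the XXZ Hamiltonian under graph isomorphisms**: relabelling the sites along a bijection
carrying the bonds of `G` onto those of `G'` carries `H^{XXZ}_G` to `H^{XXZ}_{G'}` (the Heisenberg case is the
tree's `reindexOp_heisenbergHamiltonian`). [cite: Tasaki2020, §2.4 eq. (2.4.1)] -/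
theorem reindexOp_xxzHamiltonian (G : SimpleGraph V) [DecidableRel G.Adj] (G' : SimpleGraph W)
    [DecidableRel G'.Adj] (e : V ≃ W) (hadj : ∀ x y, G'.Adj (e x) (e y) ↔ G.Adj x y) (J Δ : ℝ) :
    reindexOp e (xxzHamiltonian n G J Δ) = xxzHamiltonian n G' J Δ := by
  unfold xxzHamiltonian
  rw [map_smul, map_sum]
  congr 1
  refine Finset.sum_nbij (Sym2.map e) ?_ ?_ ?_ ?_
  · intro s hs
    induction s using Sym2.ind with
    | _ x y =>
      rw [SimpleGraph.mem_edgeFinset, SimpleGraph.mem_edgeSet] at hs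
      rw [Sym2.map_mk, SimpleGraph.mem_edgeFinset, SimpleGraph.mem_edgeSet]
      exact (hadj x y).2 hs
  · exact fun s _ s' _ h => Sym2.map.injective e.injective h
  · intro s' hs'
    refine ⟨Sym2.map e.symm s', ?_, by rw [Sym2.map_map]; simp⟩
    induction s' using Sym2.ind with
    | _ x y =>
      rw [Finset.mem_coe, SimpleGraph.mem_edgeFinset, SimpleGraph.mem_edgeSet] at hs'
      rw [Sym2.map_mk, Finset.mem_coe, SimpleGraph.mem_edgeFinset, SimpleGraph.mem_edgeSet,
        ← hadj, Equiv.apply_symm_apply, Equiv.apply_symm_apply]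
      exact hs'
  · intro s _
    induction s using Sym2.ind with
    | _ x y =>
      rw [Sym2.map_mk, Sym2.lift_mk, Sym2.lift_mk]
      simp only [map_add, map_smul, reindexOp_spinBond]

/-- Relabelling moves the staggered spin along: `reindexOp e (Σ_x (-1)^{σ x} S^α_x) = Σ_x (-1)^{σ x} S^α_{e x}`.
[cite: BratteliRobinsonII1997, §6.2.1] -/
theorem reindexOp_stagSpin (e : V ≃ W) (σ : V → ℕ) (α : Fin 3) :
    reindexOp e (stagSpin n σ α) = ∑ x, (stagSign σ x : ℂ) • (siteSpin n (e x) α : Op W (n + 1)) := by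
  rw [stagSpin, map_sum]
  exact Finset.sum_congr rfl fun x _ => by rw [map_smul, reindexOp_siteSpin]

/-- **The global flip of one spin component (KT93 (2.3), (2.5)).**  For each component `α` there is a unitary `W`
(the global half turn about the `3`-axis for `α ∈ {x, y}`, about the `2`-axis for `α = z` — the tree's `halfTurn`,
`halfTurnY`) fixing every XXZ Hamiltonian and reversing the `α`-component of every spin:
`W H Wᴴ = H`, `W S^α_z Wᴴ = -S^α_z`. [cite: KomaTasaki1993, §2 (2.3), (2.5)] -/
theorem exists_siteSpin_flip (G : SimpleGraph V) [DecidableRel G.Adj] (J Δ : ℝ) (α : Fin 3) :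
    ∃ Wf : Op V (n + 1), Wfᴴ * Wf = 1 ∧ Wf * Wfᴴ = 1 ∧
      Wf * xxzHamiltonian n G J Δ * Wfᴴ = xxzHamiltonian n G J Δ ∧
      ∀ z : V, Wf * siteSpin n z α * Wfᴴ = -siteSpin n z α := by
  fin_cases α
  · exact ⟨halfTurn n, halfTurn_conjTranspose_mul n, halfTurn_mul_conjTranspose n,
      halfTurn_conj_xxzHamiltonian n G J Δ, halfTurn_conj_siteSpin_zero n⟩
  · exact ⟨halfTurn n, halfTurn_conjTranspose_mul n, halfTurn_mul_conjTranspose n,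
      halfTurn_conj_xxzHamiltonian n G J Δ, halfTurn_conj_siteSpin_one n⟩
  · exact ⟨halfTurnY n, halfTurnY_conjTranspose_mul n, halfTurnY_mul_conjTranspose n,
      halfTurnY_conj_xxzHamiltonian n G J Δ, halfTurnY_conj_siteSpin_two n⟩

/-- The flip reverses the staggered spin: `W O^α Wᴴ = -O^α`. [cite: KomaTasaki1993, §2 (2.5)] -/
theorem flip_conj_stagSpin {Wf : Op V (n + 1)} {α : Fin 3} (hW : ∀ z : V, Wf * siteSpin n z α * Wfᴴ = -siteSpin n z α)
    (σ : V → ℕ) : Wf * stagSpin n σ α * Wfᴴ = -stagSpin n σ α := by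
  rw [stagSpin, Finset.mul_sum, Finset.sum_mul, ← Finset.sum_neg_distrib]
  refine Finset.sum_congr rfl fun x _ => ?_
  rw [Matrix.mul_smul, Matrix.smul_mul, hW, smul_neg]

end Graph

/-! ### §1b Parities: the Néel sign on the even torus -/

section Parity

variable {d L : ℕ} [NeZero L]

omit [NeZero L] in
/-- `(-1)^{m mod L} = (-1)^m` for even `L`. [cite: DLS1978, §1] -/
theorem neg_one_pow_mod_of_even (hL : Even L) (m : ℕ) : ((-1 : ℝ) ^ (m % L)) = (-1) ^ m := by
  conv_rhs => rw [← Nat.mod_add_div m L, pow_add, pow_mul, hL.neg_one_pow, one_pow, mul_one]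

/-- Signs with exponents of equal parity agree. [cite: DLS1978, §1] -/
theorem neg_one_pow_eq_of_even_iff {a b : ℕ} (h : Even a ↔ Even b) : ((-1 : ℝ) ^ a) = (-1) ^ b := by
  rcases Nat.even_or_odd a with ha | ha
  · rw [ha.neg_one_pow, (h.1 ha).neg_one_pow]
  · have hb : Odd b := Nat.not_even_iff_odd.1 fun hb => (Nat.not_even_iff_odd.2 ha) (h.2 hb)
    rw [ha.neg_one_pow, hb.neg_one_pow]

/-- **The Néel sign is multiplicative on the even torus**: `(-1)^{y+v} = (-1)^y (-1)^v` on `(ℤ/Lℤ)^d`, `L` even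
(with the canonical representatives `Σ_i (y_i mod L)` as exponents). [cite: DLS1978, §1] -/
theorem stagSign_torusParityExp_add (hL : Even L) (y v : TorusSite d L) :
    stagSign (torusParityExp d L) (y + v) = stagSign (torusParityExp d L) y * stagSign (torusParityExp d L) v := by
  simp only [stagSign, torusParityExp, ← pow_add, ← Finset.sum_add_distrib]
  rw [← Finset.prod_pow_eq_pow_sum, ← Finset.prod_pow_eq_pow_sum]
  refine Finset.prod_congr rfl fun i _ => ?_
  rw [Pi.add_apply, ZMod.val_add, neg_one_pow_mod_of_even hL]

/-- On the even torus `(-1)^v (-1)^{y+v} = (-1)^y`. [cite: DLS1978, §1] -/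
theorem stagSign_mul_stagSign_add (hL : Even L) (y v : TorusSite d L) :
    stagSign (torusParityExp d L) v * stagSign (torusParityExp d L) (y + v) = stagSign (torusParityExp d L) y := by
  rw [stagSign_torusParityExp_add hL, mul_comm (stagSign _ y), ← mul_assoc, stagSign_mul_self, one_mul]

/-- **The Néel sign of `ℤ^d` survives reduction mod an even `L`**: `(-1)^{x mod L} = (-1)^{Σ_i |x_i|}`
(`latticeStagger`). [cite: DLS1978, §1] -/
theorem stagSign_torusParityExp_proj (hL : Even L) (x : Site d) :
    stagSign (torusParityExp d L) (Torus.proj L x) = latticeStagger x := by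
  simp only [stagSign, torusParityExp, latticeStagger_apply, Torus.proj_apply]
  rw [← Finset.prod_pow_eq_pow_sum, ← Finset.prod_pow_eq_pow_sum]
  refine Finset.prod_congr rfl fun i _ => neg_one_pow_eq_of_even_iff ?_
  have hv : (((x i : ℤ) : ZMod L).val : ℤ) = x i % (L : ℤ) := ZMod.val_intCast (x i)
  have hLz : Even (L : ℤ) := by
    obtain ⟨c, hc⟩ := hL
    exact ⟨c, by rw [hc]; push_cast; rfl⟩
  rw [Int.natAbs_even, ← Int.even_coe_nat, hv, Int.emod_def, Int.even_sub]
  exact iff_true_right (hLz.mul_right _)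

end Parity

/-! ### §1c The sourced torus Hamiltonian `K = H - B·O^α` and its lattice symmetries -/

section Torus

variable {d L : ℕ} [NeZero L] (n : ℕ)

/-- **The sourced XXZ antiferromagnet on the torus**: `K = H^{XXZ}_{(ℤ/Lℤ)^d}(J, Δ) - B·O^α`,
`O^α = Σ_y (-1)^{y} S^α_y` (KT93 (1.8): `H_Λ - BO_Λ`). [cite: KomaTasaki1993, §1 (1.8)] -/
abbrev sourcedAF (d L : ℕ) [NeZero L] (n : ℕ) (J Δ : ℝ) (α : Fin 3) (B : ℝ) : Op (TorusSite d L) (n + 1) :=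
  xxzHamiltonian n (torusGraph d L) J Δ - (B : ℂ) • stagSpin n (torusParityExp d L) α

/-- `K` is Hermitian. [cite: KomaTasaki1993, §1 (1.8)] -/
theorem sourcedAF_isHermitian (J Δ : ℝ) (α : Fin 3) (B : ℝ) : (sourcedAF d L n J Δ α B).IsHermitian :=
  (xxzHamiltonian_isHermitian n _ J Δ).sub ((isHermitian_stagSpin n _ α).smul
    (by rw [isSelfAdjoint_iff, Complex.star_def, Complex.conj_ofReal]))

/-- **The XXZ Hamiltonian of the torus is invariant under `y ↦ εy + v`** (translations and reflections).
[cite: Tasaki2020, §2.4 eq. (2.4.1)] -/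
theorem reindexOp_torusAff_xxzHamiltonian (ε : ℤˣ) (v : TorusSite d L) (J Δ : ℝ) :
    reindexOp (torusAff ε v) (xxzHamiltonian n (torusGraph d L) J Δ) = xxzHamiltonian n (torusGraph d L) J Δ :=
  reindexOp_xxzHamiltonian n _ _ (torusAff ε v) (torusGraph_adj_torusAff ε v) J Δ

/-- **A translation multiplies the staggered spin by its sign** (even torus):
`reindexOp (y ↦ y + v) O^α = (-1)^v O^α`. [cite: KomaTasaki1993, §1 (1.2)] -/
theorem reindexOp_addRight_stagSpin (hL : Even L) (v : TorusSite d L) (α : Fin 3) :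
    reindexOp (Equiv.addRight v) (stagSpin n (torusParityExp d L) α) =
      (stagSign (torusParityExp d L) v : ℂ) • stagSpin n (torusParityExp d L) α := by
  rw [reindexOp_stagSpin]
  calc ∑ x, (stagSign (torusParityExp d L) x : ℂ) •
          (siteSpin n (Equiv.addRight v x) α : Op (TorusSite d L) (n + 1))
      = ∑ x, (stagSign (torusParityExp d L) v : ℂ) •
          ((stagSign (torusParityExp d L) (x + v) : ℂ) • (siteSpin n (x + v) α : Op (TorusSite d L) (n + 1))) :=
        Finset.sum_congr rfl fun x _ => by
          rw [Equiv.coe_addRight, smul_smul, ← Complex.ofReal_mul, stagSign_mul_stagSign_add hL]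
    _ = (stagSign (torusParityExp d L) v : ℂ) • stagSpin n (torusParityExp d L) α := by
        rw [← Finset.smul_sum, stagSpin]
        congr 1
        exact Equiv.sum_comp (Equiv.addRight v) (fun w => (stagSign (torusParityExp d L) w : ℂ) •
          (siteSpin n w α : Op (TorusSite d L) (n + 1)))

/-- **Translating the sourced Hamiltonian**: `P_v K(B) P_vᴴ = K((-1)^v B)` on the even torus
(`P_v = permOp (y ↦ y + v)`). [cite: KomaTasaki1993, §1 (1.8)] -/
theorem permOp_conj_sourcedAF (hL : Even L) (v : TorusSite d L) (J Δ : ℝ) (α : Fin 3) (B : ℝ) :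
    permOp (torusAff 1 v) * sourcedAF d L n J Δ α B * (permOp (torusAff 1 v))ᴴ =
      sourcedAF d L n J Δ α (stagSign (torusParityExp d L) v * B) := by
  rw [permOp_mul_mul_conjTranspose, sourcedAF, map_sub, map_smul, reindexOp_torusAff_xxzHamiltonian,
    torusAff_one, reindexOp_addRight_stagSpin n hL, smul_smul, sourcedAF, Complex.ofReal_mul, mul_comm]

/-- **Translating a spin**: `P_v S^α_y P_vᴴ = S^α_{y+v}`. [cite: BratteliRobinsonII1997, §6.2.1] -/
theorem permOp_conj_siteSpin (v y : TorusSite d L) (α : Fin 3) :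
    permOp (torusAff 1 v) * siteSpin n y α * (permOp (torusAff 1 v))ᴴ =
      (siteSpin n (y + v) α : Op (TorusSite d L) (n + 1)) := by
  rw [permOp_mul_mul_conjTranspose, reindexOp_siteSpin, torusAff_one, Equiv.coe_addRight]

/-- **The flipped sourced Hamiltonian**: `W K(B) Wᴴ = K(-B)` for the global flip `W` of the `α`-component.
[cite: KomaTasaki1993, §2 (2.3), (2.5)] -/
theorem flip_conj_sourcedAF {Wf : Op (TorusSite d L) (n + 1)} {J Δ : ℝ} {α : Fin 3}
    (hH : Wf * xxzHamiltonian n (torusGraph d L) J Δ * Wfᴴ = xxzHamiltonian n (torusGraph d L) J Δ)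
    (hW : ∀ z, Wf * siteSpin n z α * Wfᴴ = -siteSpin n z α) (B : ℝ) :
    Wf * sourcedAF d L n J Δ α B * Wfᴴ = sourcedAF d L n J Δ α (-B) := by
  rw [sourcedAF, Matrix.mul_sub, Matrix.sub_mul, hH, Matrix.mul_smul, Matrix.smul_mul,
    flip_conj_stagSpin n hW, smul_neg, ← neg_smul, sourcedAF, Complex.ofReal_neg]

/-! ### §1d The sublattice symmetry of symmetric states ("the equality in (1.9)") -/

/-- **Symmetric states of the sourced antiferromagnet are staggered-homogeneous.**  On the even torus, let
`ρ` be a linear functional on the spin algebra invariant under conjugation by every unitary commuting with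
`K = H - B·O^α` (e.g. a Gibbs state or the tracial ground state of `K`).  Then for every site `y`,
`(-1)^y ρ(S^α_y) = |Λ|⁻¹ ρ(O^α)`: the staggered one-point function is constant and equals the order parameter
density — "the equality in (1.9) follows from the translation invariance" (translations by even `v`, and
translations by odd `v` composed with the global flip (2.5), are symmetries of `K`).
[cite: KomaTasaki1993, §1 (1.9)] -/
theorem stagSign_mul_apply_siteSpin_eq_avg (hL : Even L) (J Δ : ℝ) (α : Fin 3) (B : ℝ)
    (ρ : Op (TorusSite d L) (n + 1) →ₗ[ℂ] ℂ)
    (hρ : ∀ U : Op (TorusSite d L) (n + 1), Uᴴ * U = 1 → U * Uᴴ = 1 →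
      U * sourcedAF d L n J Δ α B * Uᴴ = sourcedAF d L n J Δ α B → ∀ X, ρ (U * X * Uᴴ) = ρ X)
    (y : TorusSite d L) :
    (stagSign (torusParityExp d L) y : ℂ) * ρ (siteSpin n y α) =
      ((Fintype.card (TorusSite d L) : ℂ))⁻¹ * ρ (stagSpin n (torusParityExp d L) α) := by
  obtain ⟨Wf, hW1, hW2, hWH, hWS⟩ := exists_siteSpin_flip n (torusGraph d L) J Δ α
  set s : TorusSite d L → ℝ := stagSign (torusParityExp d L) with hs
  -- the staggered one-point function is translation invariant
  have key : ∀ v : TorusSite d L, (s (y + v) : ℂ) * ρ (siteSpin n (y + v) α) = (s y : ℂ) * ρ (siteSpin n y α) := by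
    intro v
    have hsv : s v = 1 ∨ s v = -1 := neg_one_pow_eq_or ℝ _
    have hsy : s (y + v) = s y * s v := stagSign_torusParityExp_add hL y v
    rcases hsv with h1 | h1
    · -- even translation: `P_v` commutes with `K`
      have hU := hρ (permOp (torusAff 1 v)) (conjTranspose_permOp_mul _) (permOp_mul_conjTranspose _)
        (by rw [permOp_conj_sourcedAF n hL, ← hs, h1, one_mul]) (siteSpin n y α)
      rw [permOp_conj_siteSpin] at hU
      rw [hU, hsy, h1, mul_one]
    · -- odd translation composed with the flip
      have hUU1 : (permOp (torusAff 1 v) * Wf)ᴴ * (permOp (torusAff 1 v) * Wf) = 1 := by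
        rw [conjTranspose_mul, Matrix.mul_assoc, ← Matrix.mul_assoc _ (permOp _) Wf, conjTranspose_permOp_mul,
          Matrix.one_mul, hW1]
      have hUU2 : permOp (torusAff 1 v) * Wf * (permOp (torusAff 1 v) * Wf)ᴴ = 1 := by
        rw [conjTranspose_mul, Matrix.mul_assoc, ← Matrix.mul_assoc Wf, hW2, Matrix.one_mul,
          permOp_mul_conjTranspose]
      have hUK : permOp (torusAff 1 v) * Wf * sourcedAF d L n J Δ α B * (permOp (torusAff 1 v) * Wf)ᴴ =
          sourcedAF d L n J Δ α B := by
        rw [conjTranspose_mul, show permOp (torusAff 1 v) * Wf * sourcedAF d L n J Δ α B *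
            (Wfᴴ * (permOp (torusAff 1 v))ᴴ) = permOp (torusAff 1 v) * (Wf * sourcedAF d L n J Δ α B * Wfᴴ) *
            (permOp (torusAff 1 v))ᴴ by simp only [Matrix.mul_assoc], flip_conj_sourcedAF n hWH hWS,
          permOp_conj_sourcedAF n hL, ← hs, h1]
        congr 1; ring
      have hU := hρ _ hUU1 hUU2 hUK (siteSpin n y α)
      rw [conjTranspose_mul, show permOp (torusAff 1 v) * Wf * siteSpin n y α * (Wfᴴ * (permOp (torusAff 1 v))ᴴ) =
          permOp (torusAff 1 v) * (Wf * siteSpin n y α * Wfᴴ) * (permOp (torusAff 1 v))ᴴ by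
          simp only [Matrix.mul_assoc], hWS, Matrix.mul_neg, Matrix.neg_mul, permOp_conj_siteSpin, map_neg] at hU
      rw [hsy, h1, ← hU]
      push_cast
      ring
  -- average over the translations
  have hsum : ∑ v : TorusSite d L, (s (y + v) : ℂ) * ρ (siteSpin n (y + v) α) =
      ρ (stagSpin n (torusParityExp d L) α) := by
    rw [stagSpin, map_sum]
    simp_rw [map_smul, smul_eq_mul]
    exact Equiv.sum_comp (Equiv.addLeft y) (fun w => (s w : ℂ) * ρ (siteSpin n w α))
  have hcard : (Fintype.card (TorusSite d L) : ℂ) ≠ 0 := Nat.cast_ne_zero.2 Fintype.card_ne_zero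
  rw [← hsum, Finset.sum_congr rfl fun v _ => key v, Finset.sum_const, Finset.card_univ, nsmul_eq_mul,
    ← mul_assoc, inv_mul_cancel₀ hcard, one_mul]

/-- The same identity solved for the one-point function: `ρ(S^α_y) = (-1)^y |Λ|⁻¹ ρ(O^α)`.
[cite: KomaTasaki1993, §1 (1.9)] -/
theorem apply_siteSpin_eq_stagSign_mul_avg (hL : Even L) (J Δ : ℝ) (α : Fin 3) (B : ℝ)
    (ρ : Op (TorusSite d L) (n + 1) →ₗ[ℂ] ℂ)
    (hρ : ∀ U : Op (TorusSite d L) (n + 1), Uᴴ * U = 1 → U * Uᴴ = 1 →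
      U * sourcedAF d L n J Δ α B * Uᴴ = sourcedAF d L n J Δ α B → ∀ X, ρ (U * X * Uᴴ) = ρ X)
    (y : TorusSite d L) :
    ρ (siteSpin n y α) = (stagSign (torusParityExp d L) y : ℂ) *
      (((Fintype.card (TorusSite d L) : ℂ))⁻¹ * ρ (stagSpin n (torusParityExp d L) α)) := by
  rw [← stagSign_mul_apply_siteSpin_eq_avg n hL J Δ α B ρ hρ y, ← mul_assoc, ← Complex.ofReal_mul,
    stagSign_mul_self, Complex.ofReal_one, one_mul]

/-- **Gibbs states are invariant under the symmetries of the Hamiltonian**: `⟨U X Uᴴ⟩_{β,K} = ⟨X⟩_{β,K}` for a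
unitary `U` with `U K Uᴴ = K`. [cite: BratteliRobinsonII1997, §6.2.2] -/
theorem gibbsState_conj_of_symmetry {m : Type*} [Fintype m] [DecidableEq m] (β : ℝ) {K U : Matrix m m ℂ}
    (hU1 : Uᴴ * U = 1) (hU2 : U * Uᴴ = 1) (hUK : U * K * Uᴴ = K) (X : Matrix m m ℂ) :
    gibbsState β K (U * X * Uᴴ) = gibbsState β K X := by
  have hK : Uᴴ * K * U = K := by
    conv_lhs => rw [← hUK]
    simp only [← Matrix.mul_assoc]
    rw [hU1, Matrix.one_mul, Matrix.mul_assoc, hU1, Matrix.mul_one]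
  rw [← Matrix.gibbsState_conjTranspose_mul_mul hU2 hU1, hK]

/-- **The tracial ground state is invariant under the symmetries of the Hamiltonian.**
[cite: Tasaki2020, §2.1] -/
theorem groundStateFunctional_conj_of_symmetry {m : Type*} [Fintype m] [DecidableEq m] {K U : Matrix m m ℂ}
    (hK : K.IsHermitian) (hU1 : Uᴴ * U = 1) (hUK : U * K * Uᴴ = K) (X : Matrix m m ℂ) :
    K.groundStateFunctional (U * X * Uᴴ) = K.groundStateFunctional X := by
  have hc : U * K = K * U := by
    have h := congrArg (· * U) hUK
    simp only [Matrix.mul_assoc, hU1, Matrix.mul_one] at h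
    exact h
  exact Matrix.groundStateFunctional_conj_of_commute hK hc hU1 X

/-- **(1.9) in finite volume, thermal**: `⟨S^α_y⟩_{β, H-BO} = (-1)^y |Λ|⁻¹⟨O^α⟩_{β, H-BO}` on the even torus.
[cite: KomaTasaki1993, §1 (1.9)] -/
theorem gibbsState_siteSpin_eq (hL : Even L) (J Δ : ℝ) (α : Fin 3) (β B : ℝ) (y : TorusSite d L) :
    gibbsState β (sourcedAF d L n J Δ α B) (siteSpin n y α) = (stagSign (torusParityExp d L) y : ℂ) *
      (((Fintype.card (TorusSite d L) : ℂ))⁻¹ *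
        gibbsState β (sourcedAF d L n J Δ α B) (stagSpin n (torusParityExp d L) α)) :=
  apply_siteSpin_eq_stagSign_mul_avg n hL J Δ α B _
    (fun _ hU1 hU2 hUK X => gibbsState_conj_of_symmetry β hU1 hU2 hUK X) y

/-- **(1.9) in finite volume, ground state**: the tracial ground state of `H - BO` on the even torus has
`ω_GS(S^α_y) = (-1)^y |Λ|⁻¹ ω_GS(O^α)`. [cite: KomaTasaki1993, §1 (1.9), §7] -/
theorem groundStateFunctional_siteSpin_eq (hL : Even L) (J Δ : ℝ) (α : Fin 3) (B : ℝ) (y : TorusSite d L) :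
    (sourcedAF d L n J Δ α B).groundStateFunctional (siteSpin n y α) = (stagSign (torusParityExp d L) y : ℂ) *
      (((Fintype.card (TorusSite d L) : ℂ))⁻¹ *
        (sourcedAF d L n J Δ α B).groundStateFunctional (stagSpin n (torusParityExp d L) α)) :=
  apply_siteSpin_eq_stagSign_mul_avg n hL J Δ α B _
    (fun _ hU1 _ hUK X => groundStateFunctional_conj_of_symmetry (sourcedAF_isHermitian n J Δ α B) hU1 hUK X) y

end Torus

/-! ### §2 The states of KT93 (1.8): sourced limit states and infinitesimal-field states -/

section InfiniteVolume

variable {d n : ℕ}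

/-- `(-1)^x (-1)^x = 1` for the Néel sign of `ℤ^d`. [cite: DLS1978, §1] -/
theorem latticeStagger_mul_self (x : Site d) : latticeStagger x * latticeStagger x = 1 := by
  rw [latticeStagger_apply, ← pow_add, ← two_mul, pow_mul, neg_one_sq, one_pow]

/-- The even sides `2k + 2 → ∞`. [cite: KomaTasaki1993, §1 (1.5)] -/
theorem tendsto_two_mul_add_two {κ : ℕ → ℕ} (hκ : StrictMono κ) :
    Tendsto (fun j => 2 * κ j + 2) atTop atTop :=
  tendsto_atTop_atTop.2 fun b => ⟨b, fun j hj => (hj.trans (hκ.id_le j)).trans (by omega)⟩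

/-- **A sourced limit state** of the antiferromagnet along even tori: `ω` is the thermodynamic limit
(`InfVolState.IsTorusLimitOf`) of the finite-volume states `ρ k` of the tori `(ℤ/(2k+2)ℤ)^d` along a strictly
increasing sequence of sizes `k = κ_j` — the inner limit `lim_{L↑∞}` of KT93 (1.8), realised along a subsequence
(no uniqueness of the limit is claimed or needed).  The family `ρ` is a parameter: the Gibbs states of
`H - BO` give `IsSourcedThermalLimit`, their `β → ∞` limits (tracial ground states) `IsSourcedGroundStateLimit`.
[cite: KomaTasaki1993, §1 (1.5), (1.8)] -/
def IsSourcedLimit (ρ : ∀ k : ℕ, Op (TorusSite d (2 * k + 2)) (n + 1) →ₗ[ℂ] ℂ) (ω : InfVolState d (n + 1)) : Prop :=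
  ∃ κ : ℕ → ℕ, StrictMono κ ∧ ω.IsTorusLimitOf (Ls := fun j => 2 * κ j + 2) (fun j => ρ (κ j))

/-- **An infinitesimal-field state**: `ω` is a pointwise (weak-⋆, on every local algebra) limit of sourced limit
states `ω_m` at source strengths `B_m > 0` with `B_m → 0` — the outer limit `lim_{B↓0}` of KT93 (1.8), realised
along a sequence.  The sourced family `ρ B k` is a parameter (Gibbs / tracial ground states of `H - B·O^α`).
[cite: KomaTasaki1993, §1 (1.8)] -/
def IsInfinitesimalFieldState (ρ : ℝ → ∀ k : ℕ, Op (TorusSite d (2 * k + 2)) (n + 1) →ₗ[ℂ] ℂ)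
    (ω : InfVolState d (n + 1)) : Prop :=
  ∃ (B : ℕ → ℝ) (ωB : ℕ → InfVolState d (n + 1)), (∀ m, 0 < B m) ∧ Tendsto B atTop (𝓝 0) ∧
    (∀ m, IsSourcedLimit (ρ (B m)) (ωB m)) ∧
    ∀ (Λ : Finset (Site d)) (A : Op ↥Λ (n + 1)), Tendsto (fun m => (ωB m).expect Λ A) atTop (𝓝 (ω.expect Λ A))

/-- **Sourced limit states exist** for every family of normalised positive functionals (weak-⋆ compactness,
`InfVolState.exists_isTorusLimitOf_subseq`). [cite: BratteliRobinsonI1987, Thm. 2.3.15] -/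
theorem exists_isSourcedLimit (ρ : ∀ k : ℕ, Op (TorusSite d (2 * k + 2)) (n + 1) →ₗ[ℂ] ℂ)
    (h1 : ∀ k, ρ k 1 = 1) (hpos : ∀ k (X : Op (TorusSite d (2 * k + 2)) (n + 1)), 0 ≤ ρ k (Xᴴ * X)) :
    ∃ ω : InfVolState d (n + 1), IsSourcedLimit ρ ω := by
  obtain ⟨φ, hφ, ω, hω⟩ := InfVolState.exists_isTorusLimitOf_subseq (Ls := fun k => 2 * k + 2)
    (tendsto_two_mul_add_two strictMono_id) ρ h1 hpos
  exact ⟨ω, φ, hφ, hω⟩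

/-- **Infinitesimal-field states exist** (compactness twice: at each `B_m = 1/(m+1)` and then along `m`,
`InfVolState.exists_tendsto_expect_subseq`). [cite: BratteliRobinsonI1987, Thm. 2.3.15] -/
theorem exists_isInfinitesimalFieldState (ρ : ℝ → ∀ k : ℕ, Op (TorusSite d (2 * k + 2)) (n + 1) →ₗ[ℂ] ℂ)
    (h1 : ∀ B k, ρ B k 1 = 1) (hpos : ∀ B k (X : Op (TorusSite d (2 * k + 2)) (n + 1)), 0 ≤ ρ B k (Xᴴ * X)) :
    ∃ ω : InfVolState d (n + 1), IsInfinitesimalFieldState ρ ω := by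
  have hex : ∀ m : ℕ, ∃ ω : InfVolState d (n + 1), IsSourcedLimit (ρ (1 / ((m : ℝ) + 1))) ω :=
    fun m => exists_isSourcedLimit _ (h1 _) (hpos _)
  choose ωB hωB using hex
  obtain ⟨φ, hφ, ωl, hωl⟩ := InfVolState.exists_tendsto_expect_subseq ωB
  refine ⟨ωl, fun m => 1 / ((φ m : ℝ) + 1), fun m => ωB (φ m), fun m => by positivity, ?_,
    fun m => hωB (φ m), hωl⟩
  exact tendsto_one_div_add_atTop_nhds_zero_nat.comp hφ.tendsto_atTop

/-! #### The one-point dictionary (1.9) and the even-translation invariance of sourced limit states -/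

/-- **The one-site observable** `S^α_x ∈ 𝔄_{{x}}` of the infinite system. [cite: BratteliRobinsonII1997, §6.2.1] -/
abbrev siteSpinAt (n : ℕ) (x : Site d) (α : Fin 3) : Op ↥({x} : Finset (Site d)) (n + 1) :=
  siteSpin n (⟨x, mem_singleton_self x⟩ : ↥({x} : Finset (Site d))) α

variable {ρ : ∀ k : ℕ, Op (TorusSite d (2 * k + 2)) (n + 1) →ₗ[ℂ] ℂ} {ω : InfVolState d (n + 1)} {α : Fin 3}

/-- **(1.9) along a torus limit: `|Λ_j|⁻¹ Re ρ_j(O^α) → (-1)^x Re ω(S^α_x)` for EVERY site `x`**, whenever the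
finite-volume states satisfy the sublattice identity `ρ_k(S^α_y) = (-1)^y|Λ|⁻¹ρ_k(O^α)` (Gibbs and tracial ground
states of `H - BO^α` do: `gibbsState_siteSpin_eq`, `groundStateFunctional_siteSpin_eq`).
[cite: KomaTasaki1993, §1 (1.9)] -/
theorem tendsto_avg_stagSpin_of_isTorusLimitOf {κ : ℕ → ℕ}
    (hω : ω.IsTorusLimitOf (Ls := fun j => 2 * κ j + 2) (fun j => ρ (κ j)))
    (hρ : ∀ (k : ℕ) (y : TorusSite d (2 * k + 2)), ρ k (siteSpin n y α) =
      (stagSign (torusParityExp d (2 * k + 2)) y : ℂ) * ((((Fintype.card (TorusSite d (2 * k + 2)) : ℂ))⁻¹ *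
        ρ k (stagSpin n (torusParityExp d (2 * k + 2)) α))))
    (x : Site d) :
    Tendsto (fun j => ((Fintype.card (TorusSite d (2 * κ j + 2)) : ℝ))⁻¹ *
        (ρ (κ j) (stagSpin n (torusParityExp d (2 * κ j + 2)) α)).re) atTop
      (𝓝 (latticeStagger x * (ω.expect {x} (siteSpinAt n x α)).re)) := by
  have h1 := ((Complex.continuous_re.tendsto _).comp (hω.tendsto_onSite x (spinVec n α))).const_mul
    (latticeStagger x)
  refine h1.congr fun j => ?_
  have hk : Even (2 * κ j + 2) := ⟨κ j + 1, by ring⟩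
  rw [Function.comp_apply, show (onSite (Torus.proj (2 * κ j + 2) x) (spinVec n α) :
      Op (TorusSite d (2 * κ j + 2)) (n + 1)) = siteSpin n (Torus.proj (2 * κ j + 2) x) α from rfl, hρ,
    stagSign_torusParityExp_proj hk, Complex.re_ofReal_mul, ← mul_assoc, latticeStagger_mul_self, one_mul,
    ← Complex.ofReal_natCast, ← Complex.ofReal_inv, Complex.re_ofReal_mul]

/-- **The staggered one-point function of a sourced limit state is site-independent**:
`(-1)^x Re ω(S^α_x) = (-1)^y Re ω(S^α_y)` (both are the limit of `|Λ_j|⁻¹ Re ρ_j(O^α)`).  This common value is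
the state's spontaneous staggered magnetisation `m_s` of KT93 (1.9). [cite: KomaTasaki1993, §1 (1.9)] -/
theorem IsSourcedLimit.stagMagnetisation_eq (h : IsSourcedLimit ρ ω)
    (hρ : ∀ (k : ℕ) (y : TorusSite d (2 * k + 2)), ρ k (siteSpin n y α) =
      (stagSign (torusParityExp d (2 * k + 2)) y : ℂ) * ((((Fintype.card (TorusSite d (2 * k + 2)) : ℂ))⁻¹ *
        ρ k (stagSpin n (torusParityExp d (2 * k + 2)) α))))
    (x y : Site d) :
    latticeStagger x * (ω.expect {x} (siteSpinAt n x α)).re = latticeStagger y * (ω.expect {y} (siteSpinAt n y α)).re := by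
  obtain ⟨κ, -, hω⟩ := h
  exact tendsto_nhds_unique (tendsto_avg_stagSpin_of_isTorusLimitOf hω hρ x)
    (tendsto_avg_stagSpin_of_isTorusLimitOf hω hρ y)

/-- **A finite-volume floor passes to the sourced limit state**: if `m - ε ≤ |Λ_k|⁻¹ Re ρ_k(O^α)` eventually in `k`
for every `ε > 0`, then `m ≤ (-1)^x Re ω(S^α_x)` at every site. [cite: KomaTasaki1993, §1 (1.9)–(1.10)] -/
theorem IsSourcedLimit.le_stagMagnetisation (h : IsSourcedLimit ρ ω)
    (hρ : ∀ (k : ℕ) (y : TorusSite d (2 * k + 2)), ρ k (siteSpin n y α) =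
      (stagSign (torusParityExp d (2 * k + 2)) y : ℂ) * ((((Fintype.card (TorusSite d (2 * k + 2)) : ℂ))⁻¹ *
        ρ k (stagSpin n (torusParityExp d (2 * k + 2)) α))))
    {m : ℝ} (hm : ∀ ε : ℝ, 0 < ε → ∀ᶠ k : ℕ in atTop, m - ε ≤
      ((Fintype.card (TorusSite d (2 * k + 2)) : ℝ))⁻¹ * (ρ k (stagSpin n (torusParityExp d (2 * k + 2)) α)).re)
    (x : Site d) : m ≤ latticeStagger x * (ω.expect {x} (siteSpinAt n x α)).re := by
  obtain ⟨κ, hκ, hω⟩ := h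
  have hlim := tendsto_avg_stagSpin_of_isTorusLimitOf hω hρ x
  refine le_of_forall_pos_le_add fun ε hε => ?_
  have hev : ∀ᶠ j : ℕ in atTop, m - ε ≤ ((Fintype.card (TorusSite d (2 * κ j + 2)) : ℝ))⁻¹ *
      (ρ (κ j) (stagSpin n (torusParityExp d (2 * κ j + 2)) α)).re :=
    (hm ε hε).filter_mono (f₁ := Filter.map κ atTop) hκ.tendsto_atTop
  linarith [ge_of_tendsto hlim hev]

/-- **Sourced limit states are invariant under the even translations of `ℤ^d`**, `ω ∘ τ_v = ω` for
`(-1)^v = 1`, whenever each finite-volume state is invariant under the even torus translations (Gibbs and tracial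
ground states of `H - BO^α` are). [cite: KomaTasaki1993, §1 (1.9)] -/
theorem IsSourcedLimit.shift_eq (h : IsSourcedLimit ρ ω)
    (hρP : ∀ (k : ℕ) (w : TorusSite d (2 * k + 2)), stagSign (torusParityExp d (2 * k + 2)) w = 1 →
      ∀ X, ρ k (permOp (torusAff 1 w) * X * (permOp (torusAff 1 w))ᴴ) = ρ k X)
    {v : Site d} (hv : latticeStagger v = 1) : ω.shift v = ω := by
  obtain ⟨κ, hκ, hω⟩ := h
  refine hω.shift_eq_of_invariant (tendsto_two_mul_add_two hκ) v (Eventually.of_forall fun j X => hρP _ _ ?_ X)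
  rw [stagSign_torusParityExp_proj ⟨κ j + 1, by ring⟩, hv]

variable {ρB : ℝ → ∀ k : ℕ, Op (TorusSite d (2 * k + 2)) (n + 1) →ₗ[ℂ] ℂ}

/-- **Floors survive the limit `B ↓ 0`**: if every sourced limit state at every `B > 0` has
`m ≤ (-1)^x Re ω_B(S^α_x)`, so does every infinitesimal-field state. [cite: KomaTasaki1993, §1 (1.9)–(1.10)] -/
theorem IsInfinitesimalFieldState.le_stagMagnetisation (h : IsInfinitesimalFieldState ρB ω) {m : ℝ}
    (hfloor : ∀ B : ℝ, 0 < B → ∀ ω' : InfVolState d (n + 1), IsSourcedLimit (ρB B) ω' →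
      ∀ x : Site d, m ≤ latticeStagger x * (ω'.expect {x} (siteSpinAt n x α)).re)
    (x : Site d) : m ≤ latticeStagger x * (ω.expect {x} (siteSpinAt n x α)).re := by
  obtain ⟨B, ωB, hB, -, hωB, hlim⟩ := h
  have ht := ((Complex.continuous_re.tendsto _).comp (hlim {x} (siteSpinAt n x α))).const_mul (latticeStagger x)
  exact ge_of_tendsto' ht fun m' => hfloor (B m') (hB m') (ωB m') (hωB m') x

/-- **Site-independence survives the limit `B ↓ 0`.** [cite: KomaTasaki1993, §1 (1.9)] -/
theorem IsInfinitesimalFieldState.stagMagnetisation_eq (h : IsInfinitesimalFieldState ρB ω)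
    (hρ : ∀ (B : ℝ) (k : ℕ) (y : TorusSite d (2 * k + 2)), ρB B k (siteSpin n y α) =
      (stagSign (torusParityExp d (2 * k + 2)) y : ℂ) * ((((Fintype.card (TorusSite d (2 * k + 2)) : ℂ))⁻¹ *
        ρB B k (stagSpin n (torusParityExp d (2 * k + 2)) α))))
    (x y : Site d) :
    latticeStagger x * (ω.expect {x} (siteSpinAt n x α)).re = latticeStagger y * (ω.expect {y} (siteSpinAt n y α)).re := by
  obtain ⟨B, ωB, -, -, hωB, hlim⟩ := h
  have hx := ((Complex.continuous_re.tendsto _).comp (hlim {x} (siteSpinAt n x α))).const_mul (latticeStagger x)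
  have hy := ((Complex.continuous_re.tendsto _).comp (hlim {y} (siteSpinAt n y α))).const_mul (latticeStagger y)
  exact tendsto_nhds_unique hx (hy.congr fun m => ((hωB m).stagMagnetisation_eq (hρ (B m)) x y).symm)

/-- **Infinitesimal-field states inherit the even-translation invariance.** [cite: KomaTasaki1993, §1 (1.9)] -/
theorem IsInfinitesimalFieldState.shift_eq (h : IsInfinitesimalFieldState ρB ω)
    (hρP : ∀ (B : ℝ) (k : ℕ) (w : TorusSite d (2 * k + 2)), stagSign (torusParityExp d (2 * k + 2)) w = 1 →
      ∀ X, ρB B k (permOp (torusAff 1 w) * X * (permOp (torusAff 1 w))ᴴ) = ρB B k X)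
    {v : Site d} (hv : latticeStagger v = 1) : ω.shift v = ω := by
  obtain ⟨B, ωB, -, -, hωB, hlim⟩ := h
  exact InfVolState.shift_eq_of_tendsto_expect hlim v fun m => (hωB m).shift_eq (hρP (B m)) hv

/-! #### The thermal and the ground-state specialisations -/

variable (d n)

/-- **KT93 (1.8), inner limit, `T > 0`**: `ω` is a thermodynamic limit of the Gibbs states
`⟨·⟩_{β, H_Λ - BO^α_Λ}` of the spin-`n/2` XXZ antiferromagnet (`J`, `Δ`) with staggered source along `α`, along even
tori `Λ = (ℤ/(2κ_j+2)ℤ)^d`. [cite: KomaTasaki1993, §1 (1.8)] -/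
def IsSourcedThermalLimit (J Δ : ℝ) (α : Fin 3) (β B : ℝ) (ω : InfVolState d (n + 1)) : Prop :=
  IsSourcedLimit (fun k => gibbsState β (sourcedAF d (2 * k + 2) n J Δ α B)) ω

/-- **KT93 (1.8), the infinitesimal-field state `ω̃` at inverse temperature `β`**: a weak-⋆ limit, as `B_m ↓ 0`,
of sourced thermal limit states at fields `B_m > 0`. [cite: KomaTasaki1993, §1 (1.8)] -/
def IsInfinitesimalFieldThermalState (J Δ : ℝ) (α : Fin 3) (β : ℝ) (ω : InfVolState d (n + 1)) : Prop :=
  IsInfinitesimalFieldState (fun B k => gibbsState β (sourcedAF d (2 * k + 2) n J Δ α B)) ω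

/-- **KT93 (1.8) at `T = 0`, inner limit** ("we also directly treat the ground states in a finite volume";
equivalently `β → ∞` before `Λ ↑ ℤ^d`, tree `Matrix.tendsto_gibbsState_atTop`): `ω` is a thermodynamic limit of
the tracial ground states of `H_Λ - BO^α_Λ` along even tori. [cite: KomaTasaki1993, §1 and §7] -/
def IsSourcedGroundStateLimit (J Δ : ℝ) (α : Fin 3) (B : ℝ) (ω : InfVolState d (n + 1)) : Prop :=
  IsSourcedLimit (fun k => (sourcedAF d (2 * k + 2) n J Δ α B).groundStateFunctional) ω

/-- **The infinitesimal-field ground state**: a weak-⋆ limit, as `B_m ↓ 0`, of sourced ground-state limit states.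
[cite: KomaTasaki1993, §1 (1.8) and §7] -/
def IsInfinitesimalFieldGroundState (J Δ : ℝ) (α : Fin 3) (ω : InfVolState d (n + 1)) : Prop :=
  IsInfinitesimalFieldState (fun B k => (sourcedAF d (2 * k + 2) n J Δ α B).groundStateFunctional) ω

variable {d n}

/-- Sourced thermal limit states exist for every `β`, `B`. [cite: BratteliRobinsonII1997, §6.2.2] -/
theorem exists_isSourcedThermalLimit (J Δ : ℝ) (α : Fin 3) (β B : ℝ) :
    ∃ ω : InfVolState d (n + 1), IsSourcedThermalLimit d n J Δ α β B ω :=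
  exists_isSourcedLimit _
    (fun k => gibbsState_one β _ (partitionFn_pos β (sourcedAF_isHermitian (L := 2 * k + 2) n J Δ α B)).ne')
    fun _ X => gibbsState_nonneg_of_posSemidef β (sourcedAF_isHermitian n J Δ α B) (posSemidef_conjTranspose_mul_self X)

/-- Infinitesimal-field thermal states `ω̃` exist for every `β`. [cite: KomaTasaki1993, §1 (1.8)] -/
theorem exists_isInfinitesimalFieldThermalState (J Δ : ℝ) (α : Fin 3) (β : ℝ) :
    ∃ ω : InfVolState d (n + 1), IsInfinitesimalFieldThermalState d n J Δ α β ω :=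
  exists_isInfinitesimalFieldState _
    (fun B k => gibbsState_one β _ (partitionFn_pos β (sourcedAF_isHermitian (L := 2 * k + 2) n J Δ α B)).ne')
    fun B _ X => gibbsState_nonneg_of_posSemidef β (sourcedAF_isHermitian n J Δ α B) (posSemidef_conjTranspose_mul_self X)

/-- Sourced ground-state limit states exist for every `B`. [cite: BratteliRobinsonII1997, §6.2.2] -/
theorem exists_isSourcedGroundStateLimit (J Δ : ℝ) (α : Fin 3) (B : ℝ) :
    ∃ ω : InfVolState d (n + 1), IsSourcedGroundStateLimit d n J Δ α B ω :=
  exists_isSourcedLimit _ (fun k => groundStateFunctional_one (sourcedAF_isHermitian (L := 2 * k + 2) n J Δ α B))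
    fun _ X => groundStateFunctional_nonneg _ X

/-- Infinitesimal-field ground states exist. [cite: KomaTasaki1993, §1 (1.8) and §7] -/
theorem exists_isInfinitesimalFieldGroundState (J Δ : ℝ) (α : Fin 3) :
    ∃ ω : InfVolState d (n + 1), IsInfinitesimalFieldGroundState d n J Δ α ω :=
  exists_isInfinitesimalFieldState _
    (fun B k => groundStateFunctional_one (sourcedAF_isHermitian (L := 2 * k + 2) n J Δ α B))
    fun _ _ X => groundStateFunctional_nonneg _ X

/-- The Gibbs states of `H - BO^α` are invariant under the even torus translations. [cite: KomaTasaki1993, §1 (1.9)] -/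
theorem gibbsState_permOp_conj_of_stagSign_eq_one {L : ℕ} [NeZero L] (hL : Even L) (J Δ : ℝ) (α : Fin 3) (β B : ℝ)
    {w : TorusSite d L} (hw : stagSign (torusParityExp d L) w = 1) (X : Op (TorusSite d L) (n + 1)) :
    gibbsState β (sourcedAF d L n J Δ α B) (permOp (torusAff 1 w) * X * (permOp (torusAff 1 w))ᴴ) =
      gibbsState β (sourcedAF d L n J Δ α B) X :=
  gibbsState_conj_of_symmetry β (conjTranspose_permOp_mul _) (permOp_mul_conjTranspose _)
    (by rw [permOp_conj_sourcedAF n hL, hw, one_mul]) X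

/-- The tracial ground states of `H - BO^α` are invariant under the even torus translations.
[cite: KomaTasaki1993, §1 (1.9), §7] -/
theorem groundStateFunctional_permOp_conj_of_stagSign_eq_one {L : ℕ} [NeZero L] (hL : Even L) (J Δ : ℝ)
    (α : Fin 3) (B : ℝ) {w : TorusSite d L} (hw : stagSign (torusParityExp d L) w = 1)
    (X : Op (TorusSite d L) (n + 1)) :
    (sourcedAF d L n J Δ α B).groundStateFunctional (permOp (torusAff 1 w) * X * (permOp (torusAff 1 w))ᴴ) =
      (sourcedAF d L n J Δ α B).groundStateFunctional X :=
  groundStateFunctional_conj_of_symmetry (sourcedAF_isHermitian n J Δ α B) (conjTranspose_permOp_mul _)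
    (by rw [permOp_conj_sourcedAF n hL, hw, one_mul]) X

/-- **Properties of sourced thermal limit states**: invariance under the even translations and
site-independence of the staggered one-point function. [cite: KomaTasaki1993, §1 (1.9)] -/
theorem IsSourcedThermalLimit.shift_eq_and_stagMagnetisation_eq {J Δ : ℝ} {α : Fin 3} {β B : ℝ}
    (h : IsSourcedThermalLimit d n J Δ α β B ω) :
    (∀ v : Site d, latticeStagger v = 1 → ω.shift v = ω) ∧
      ∀ x y : Site d, latticeStagger x * (ω.expect {x} (siteSpinAt n x α)).re =
        latticeStagger y * (ω.expect {y} (siteSpinAt n y α)).re :=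
  ⟨fun _ hv => IsSourcedLimit.shift_eq h
      (fun k _ hw X => gibbsState_permOp_conj_of_stagSign_eq_one ⟨k + 1, by ring⟩ J Δ α β B hw X) hv,
    fun x y => IsSourcedLimit.stagMagnetisation_eq h
      (fun k y' => gibbsState_siteSpin_eq n ⟨k + 1, by ring⟩ J Δ α β B y') x y⟩

/-- **Properties of the infinitesimal-field thermal states `ω̃`**: even-translation invariance and
site-independence of `(-1)^x Re ω̃(S^α_x)` (= KT93's `m_s`). [cite: KomaTasaki1993, §1 (1.9)] -/
theorem IsInfinitesimalFieldThermalState.shift_eq_and_stagMagnetisation_eq {J Δ : ℝ} {α : Fin 3} {β : ℝ}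
    (h : IsInfinitesimalFieldThermalState d n J Δ α β ω) :
    (∀ v : Site d, latticeStagger v = 1 → ω.shift v = ω) ∧
      ∀ x y : Site d, latticeStagger x * (ω.expect {x} (siteSpinAt n x α)).re =
        latticeStagger y * (ω.expect {y} (siteSpinAt n y α)).re :=
  ⟨fun _ hv => IsInfinitesimalFieldState.shift_eq h
      (fun B k _ hw X => gibbsState_permOp_conj_of_stagSign_eq_one ⟨k + 1, by ring⟩ J Δ α β B hw X) hv,
    fun x y => IsInfinitesimalFieldState.stagMagnetisation_eq h
      (fun B k y' => gibbsState_siteSpin_eq n ⟨k + 1, by ring⟩ J Δ α β B y') x y⟩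

/-- **Properties of sourced ground-state limit states.** [cite: KomaTasaki1993, §1 (1.9), §7] -/
theorem IsSourcedGroundStateLimit.shift_eq_and_stagMagnetisation_eq {J Δ : ℝ} {α : Fin 3} {B : ℝ}
    (h : IsSourcedGroundStateLimit d n J Δ α B ω) :
    (∀ v : Site d, latticeStagger v = 1 → ω.shift v = ω) ∧
      ∀ x y : Site d, latticeStagger x * (ω.expect {x} (siteSpinAt n x α)).re =
        latticeStagger y * (ω.expect {y} (siteSpinAt n y α)).re :=
  ⟨fun _ hv => IsSourcedLimit.shift_eq h
      (fun k _ hw X => groundStateFunctional_permOp_conj_of_stagSign_eq_one ⟨k + 1, by ring⟩ J Δ α B hw X) hv,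
    fun x y => IsSourcedLimit.stagMagnetisation_eq h
      (fun k y' => groundStateFunctional_siteSpin_eq n ⟨k + 1, by ring⟩ J Δ α B y') x y⟩

/-- **Properties of the infinitesimal-field ground states.** [cite: KomaTasaki1993, §1 (1.9), §7] -/
theorem IsInfinitesimalFieldGroundState.shift_eq_and_stagMagnetisation_eq {J Δ : ℝ} {α : Fin 3}
    (h : IsInfinitesimalFieldGroundState d n J Δ α ω) :
    (∀ v : Site d, latticeStagger v = 1 → ω.shift v = ω) ∧
      ∀ x y : Site d, latticeStagger x * (ω.expect {x} (siteSpinAt n x α)).re =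
        latticeStagger y * (ω.expect {y} (siteSpinAt n y α)).re :=
  ⟨fun _ hv => IsInfinitesimalFieldState.shift_eq h
      (fun B k _ hw X => groundStateFunctional_permOp_conj_of_stagSign_eq_one ⟨k + 1, by ring⟩ J Δ α B hw X) hv,
    fun x y => IsInfinitesimalFieldState.stagMagnetisation_eq h
      (fun B k y' => groundStateFunctional_siteSpin_eq n ⟨k + 1, by ring⟩ J Δ α B y') x y⟩

/-- **Transfer of a finite-volume sourced floor to the infinite-volume states, thermal.**  If for every `B > 0`
and `ε > 0` eventually `m - ε ≤ |Λ|⁻¹ Re⟨O^α⟩_{β, H-BO}` on the even tori, then `m ≤ (-1)^x Re ω(S^α_x)` at every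
site for every sourced thermal limit state at any `B > 0` and for every infinitesimal-field thermal state.
[cite: KomaTasaki1993, §1 (1.9)–(1.10)] -/
theorem le_stagMagnetisation_thermal_of_eventually {J Δ : ℝ} {α : Fin 3} {β m : ℝ}
    (hm : ∀ B : ℝ, 0 < B → ∀ ε : ℝ, 0 < ε → ∀ᶠ k : ℕ in atTop,
      m - ε ≤ ((Fintype.card (TorusSite d (2 * k + 2)) : ℝ))⁻¹ *
        (gibbsState β (sourcedAF d (2 * k + 2) n J Δ α B) (stagSpin n (torusParityExp d (2 * k + 2)) α)).re) :
    (∀ B : ℝ, 0 < B → ∀ ω : InfVolState d (n + 1), IsSourcedThermalLimit d n J Δ α β B ω →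
        ∀ x : Site d, m ≤ latticeStagger x * (ω.expect {x} (siteSpinAt n x α)).re) ∧
      ∀ ω : InfVolState d (n + 1), IsInfinitesimalFieldThermalState d n J Δ α β ω →
        ∀ x : Site d, m ≤ latticeStagger x * (ω.expect {x} (siteSpinAt n x α)).re := by
  have hB : ∀ B : ℝ, 0 < B → ∀ ω : InfVolState d (n + 1), IsSourcedThermalLimit d n J Δ α β B ω →
      ∀ x : Site d, m ≤ latticeStagger x * (ω.expect {x} (siteSpinAt n x α)).re :=
    fun B hB ω hω x => IsSourcedLimit.le_stagMagnetisation hω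
      (fun k y => gibbsState_siteSpin_eq n ⟨k + 1, by ring⟩ J Δ α β B y) (hm B hB) x
  exact ⟨hB, fun ω hω x => IsInfinitesimalFieldState.le_stagMagnetisation hω hB x⟩

/-- **Transfer of a finite-volume sourced floor to the infinite-volume states, ground states.**
[cite: KomaTasaki1993, §1 (1.9)–(1.10), §7] -/
theorem le_stagMagnetisation_ground_of_eventually {J Δ : ℝ} {α : Fin 3} {m : ℝ}
    (hm : ∀ B : ℝ, 0 < B → ∀ ε : ℝ, 0 < ε → ∀ᶠ k : ℕ in atTop,
      m - ε ≤ ((Fintype.card (TorusSite d (2 * k + 2)) : ℝ))⁻¹ *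
        ((sourcedAF d (2 * k + 2) n J Δ α B).groundStateFunctional (stagSpin n (torusParityExp d (2 * k + 2)) α)).re) :
    (∀ B : ℝ, 0 < B → ∀ ω : InfVolState d (n + 1), IsSourcedGroundStateLimit d n J Δ α B ω →
        ∀ x : Site d, m ≤ latticeStagger x * (ω.expect {x} (siteSpinAt n x α)).re) ∧
      ∀ ω : InfVolState d (n + 1), IsInfinitesimalFieldGroundState d n J Δ α ω →
        ∀ x : Site d, m ≤ latticeStagger x * (ω.expect {x} (siteSpinAt n x α)).re := by
  have hB : ∀ B : ℝ, 0 < B → ∀ ω : InfVolState d (n + 1), IsSourcedGroundStateLimit d n J Δ α B ω →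
      ∀ x : Site d, m ≤ latticeStagger x * (ω.expect {x} (siteSpinAt n x α)).re :=
    fun B hB ω hω x => IsSourcedLimit.le_stagMagnetisation hω
      (fun k y => groundStateFunctional_siteSpin_eq n ⟨k + 1, by ring⟩ J Δ α B y) (hm B hB) x
  exact ⟨hB, fun ω hω x => IsInfinitesimalFieldState.le_stagMagnetisation hω hB x⟩

/-! ### §3 THE FLOORS: Koma–Tasaki 1993 Corollary 1.1 with Dyson–Lieb–Simon / Kennedy–Lieb–Shastry,
in infinite volume -/

/-- **KOMA–TASAKI 1993 COROLLARY 1.1 / DYSON–LIEB–SIMON IN INFINITE VOLUME (Heisenberg antiferromagnet,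
`T > 0`, `d ≥ 3`).**  For the spin-`S` (`S = n/2 ≥ ½`) Heisenberg antiferromagnet `J Σ 𝐒_x·𝐒_y`, `J > 0`, on `ℤ^d`,
`d ≥ 3`: there is `β₀ > 0` such that for every inverse temperature `β ≥ β₀` there is `σ > 0` (the DLS/KLS long-range
order parameter at `β`) such that `√3 σ ≤ (-1)^x Re ω(Sˣ_x)` at EVERY site `x ∈ ℤ^d` — for every sourced thermal
limit state `ω = lim_Λ ⟨·⟩_{β, H_Λ - BO_Λ}` at any `B > 0`, and for every infinitesimal-field state
`ω̃ = lim_{B↓0} lim_Λ ⟨·⟩_{β, H_Λ - BO_Λ}` (KT93 (1.8)): the spontaneous staggered magnetisation `m_s` (1.9) of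
`ω̃` satisfies `m_s ≥ √3σ > 0` (1.10), at every site.  [DLS 1978 (`S ≥ 1`) and KLS 1988 (`S = ½`) give `σ > 0`;
KT93 Theorem 2.1 / Corollary 2.2 (tree, hypothesis i) removed) give the transport.]
[cite: KomaTasaki1993, Corollary 1.1 (1.10) with (1.8)–(1.9)] [cite: DLS1978, Thm. 5.2] -/
theorem heisenbergAF_infiniteVolume_spontaneousStaggeredMagnetisation (hd : 3 ≤ d) (hn : 1 ≤ n) {J : ℝ}
    (hJ : 0 < J) :
    ∃ β₀ : ℝ, 0 < β₀ ∧ ∀ β : ℝ, β₀ ≤ β → ∃ σ : ℝ, 0 < σ ∧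
      (∀ B : ℝ, 0 < B → ∀ ω : InfVolState d (n + 1), IsSourcedThermalLimit d n J 1 0 β B ω →
          ∀ x : Site d, Real.sqrt 3 * σ ≤ latticeStagger x * (ω.expect {x} (siteSpinAt n x 0)).re) ∧
        ∀ ω : InfVolState d (n + 1), IsInfinitesimalFieldThermalState d n J 1 0 β ω →
          ∀ x : Site d, Real.sqrt 3 * σ ≤ latticeStagger x * (ω.expect {x} (siteSpinAt n x 0)).re := by
  obtain ⟨β₀, hβ₀, H⟩ := heisenbergAF_thermal_spontaneousStaggeredMagnetisation hd hn hJ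
  refine ⟨β₀, hβ₀, fun β hβ => ?_⟩
  obtain ⟨σ, hσ, Hσ⟩ := H β hβ
  exact ⟨σ, hσ, le_stagMagnetisation_thermal_of_eventually Hσ⟩

/-- **XXZ ANTIFERROMAGNET WITH `0 ≤ Δ ≤ 1` (`U(1)`), `T > 0`, `d ≥ 3`, IN INFINITE VOLUME**: `√2 σ ≤ (-1)^x Re ω(Sˣ_x)`
at every site for every sourced thermal limit state and every infinitesimal-field state, `β ≥ β₀`
(KT93 Theorem 2.1 with the `U(1)` constant, Remark after Thm. 6.1). [cite: KomaTasaki1993, Thm. 2.1 and §6 Remark; §1 (1.8)–(1.9)] -/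
theorem xxzAF_infiniteVolume_spontaneousStaggeredMagnetisation (hd : 3 ≤ d) (hn : 1 ≤ n) {J : ℝ} (hJ : 0 < J)
    {Δ : ℝ} (hΔ : 0 ≤ Δ) (hΔ' : Δ ≤ 1) :
    ∃ β₀ : ℝ, 0 < β₀ ∧ ∀ β : ℝ, β₀ ≤ β → ∃ σ : ℝ, 0 < σ ∧
      (∀ B : ℝ, 0 < B → ∀ ω : InfVolState d (n + 1), IsSourcedThermalLimit d n J Δ 0 β B ω →
          ∀ x : Site d, Real.sqrt 2 * σ ≤ latticeStagger x * (ω.expect {x} (siteSpinAt n x 0)).re) ∧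
        ∀ ω : InfVolState d (n + 1), IsInfinitesimalFieldThermalState d n J Δ 0 β ω →
          ∀ x : Site d, Real.sqrt 2 * σ ≤ latticeStagger x * (ω.expect {x} (siteSpinAt n x 0)).re := by
  obtain ⟨β₀, hβ₀, H⟩ := xxzAF_thermal_spontaneousStaggeredMagnetisation hd hn hJ hΔ hΔ'
  refine ⟨β₀, hβ₀, fun β hβ => ?_⟩
  obtain ⟨σ, hσ, Hσ⟩ := H β hβ
  exact ⟨σ, hσ, le_stagMagnetisation_thermal_of_eventually Hσ⟩

/-- **XXZ ANTIFERROMAGNET WITH `Δ ≥ 1` (Ising side), `T > 0`, `d ≥ 3`, IN INFINITE VOLUME**: Néel order along `z`,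
`σ ≤ (-1)^x Re ω(Sᶻ_x)` at every site for every sourced thermal limit state (source `-B Σ(-1)^xSᶻ_x`) and every
infinitesimal-field state, `β ≥ β₀` (KT93 Theorem 2.1, non-commuting order parameter).
[cite: KomaTasaki1993, Thm. 2.1; §1 (1.8)–(1.9)] [cite: DLS1978, Thm. 5.2] -/
theorem xxzAF_infiniteVolume_spontaneousNeelMagnetisation (hd : 3 ≤ d) (hn : 1 ≤ n) {J : ℝ} (hJ : 0 < J)
    {Δ : ℝ} (hΔ : 1 ≤ Δ) :
    ∃ β₀ : ℝ, 0 < β₀ ∧ ∀ β : ℝ, β₀ ≤ β → ∃ σ : ℝ, 0 < σ ∧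
      (∀ B : ℝ, 0 < B → ∀ ω : InfVolState d (n + 1), IsSourcedThermalLimit d n J Δ 2 β B ω →
          ∀ x : Site d, σ ≤ latticeStagger x * (ω.expect {x} (siteSpinAt n x 2)).re) ∧
        ∀ ω : InfVolState d (n + 1), IsInfinitesimalFieldThermalState d n J Δ 2 β ω →
          ∀ x : Site d, σ ≤ latticeStagger x * (ω.expect {x} (siteSpinAt n x 2)).re := by
  obtain ⟨β₀, hβ₀, H⟩ := xxzAF_thermal_spontaneousNeelMagnetisation hd hn hJ hΔ
  refine ⟨β₀, hβ₀, fun β hβ => ?_⟩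
  obtain ⟨σ, hσ, Hσ⟩ := H β hβ
  exact ⟨σ, hσ, le_stagMagnetisation_thermal_of_eventually Hσ⟩

/-- **KOMA–TASAKI 1993 COROLLARY 1.1 AT `T = 0` / KENNEDY–LIEB–SHASTRY IN INFINITE VOLUME (Heisenberg
antiferromagnet, ground states, `d ≥ 2`, `(d, S) ≠ (2, ½)`).**  For `S = n/2 ≥ ½`, `J > 0`, `d ≥ 2` and not
`(d, S) = (2, ½)` (exactly where the tree proves ground-state Néel order): there is `σ > 0` such that
`√3 σ ≤ (-1)^x Re ω(Sˣ_x)` at every site for every sourced ground-state limit state at any `B > 0` and for every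
infinitesimal-field ground state `lim_{B↓0} lim_Λ ω^{GS}_{Λ,B}` (KT93 §1: "it applies to the ground state";
§7, Corollary 7.2). [cite: KomaTasaki1993, Corollary 1.1, §7 Cor. 7.2] [cite: KennedyLiebShastryJSP1988, Theorem] -/
theorem heisenbergAF_infiniteVolume_groundState_spontaneousStaggeredMagnetisation (hd : 2 ≤ d) (hn : 1 ≤ n)
    (hdn : ¬ (d = 2 ∧ n = 1)) {J : ℝ} (hJ : 0 < J) :
    ∃ σ : ℝ, 0 < σ ∧
      (∀ B : ℝ, 0 < B → ∀ ω : InfVolState d (n + 1), IsSourcedGroundStateLimit d n J 1 0 B ω →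
          ∀ x : Site d, Real.sqrt 3 * σ ≤ latticeStagger x * (ω.expect {x} (siteSpinAt n x 0)).re) ∧
        ∀ ω : InfVolState d (n + 1), IsInfinitesimalFieldGroundState d n J 1 0 ω →
          ∀ x : Site d, Real.sqrt 3 * σ ≤ latticeStagger x * (ω.expect {x} (siteSpinAt n x 0)).re := by
  obtain ⟨σ, hσ, H⟩ := heisenbergAF_ground_spontaneousStaggeredMagnetisation_groundStateFunctional hd hn hdn hJ
  refine ⟨σ, hσ, le_stagMagnetisation_ground_of_eventually fun B hB ε hε => (H B hB ε hε).mono fun k hk => ?_⟩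
  rwa [div_eq_inv_mul] at hk

/-- **XXZ ANTIFERROMAGNET `0 ≤ Δ ≤ 1`, GROUND STATES, IN INFINITE VOLUME**: `√2 σ ≤ (-1)^x Re ω(Sˣ_x)` at every site
for every sourced ground-state limit state and every infinitesimal-field ground state (`d ≥ 2`, `(d,S) ≠ (2,½)`).
[cite: KomaTasaki1993, §7 Thm. 7.3] [cite: KennedyLiebShastryJSP1988, Theorem] -/
theorem xxzAF_infiniteVolume_groundState_spontaneousStaggeredMagnetisation (hd : 2 ≤ d) (hn : 1 ≤ n)
    (hdn : ¬ (d = 2 ∧ n = 1)) {J : ℝ} (hJ : 0 < J) {Δ : ℝ} (hΔ : 0 ≤ Δ) (hΔ' : Δ ≤ 1) :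
    ∃ σ : ℝ, 0 < σ ∧
      (∀ B : ℝ, 0 < B → ∀ ω : InfVolState d (n + 1), IsSourcedGroundStateLimit d n J Δ 0 B ω →
          ∀ x : Site d, Real.sqrt 2 * σ ≤ latticeStagger x * (ω.expect {x} (siteSpinAt n x 0)).re) ∧
        ∀ ω : InfVolState d (n + 1), IsInfinitesimalFieldGroundState d n J Δ 0 ω →
          ∀ x : Site d, Real.sqrt 2 * σ ≤ latticeStagger x * (ω.expect {x} (siteSpinAt n x 0)).re := by
  obtain ⟨σ, hσ, H⟩ := xxzAF_ground_spontaneousStaggeredMagnetisation_groundStateFunctional hd hn hdn hJ hΔ hΔ'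
  refine ⟨σ, hσ, le_stagMagnetisation_ground_of_eventually fun B hB ε hε => (H B hB ε hε).mono fun k hk => ?_⟩
  rwa [div_eq_inv_mul] at hk

/-- **XXZ ANTIFERROMAGNET `Δ ≥ 1`, GROUND STATES, IN INFINITE VOLUME** (Néel order along `z`): `σ ≤ (-1)^x Re ω(Sᶻ_x)`
at every site for every sourced ground-state limit state and every infinitesimal-field ground state
(`d ≥ 2`, `(d,S) ≠ (2,½)`). [cite: KomaTasaki1993, §7 Thm. 7.1] [cite: KennedyLiebShastryJSP1988, Theorem] -/
theorem xxzAF_infiniteVolume_groundState_spontaneousNeelMagnetisation (hd : 2 ≤ d) (hn : 1 ≤ n)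
    (hdn : ¬ (d = 2 ∧ n = 1)) {J : ℝ} (hJ : 0 < J) {Δ : ℝ} (hΔ : 1 ≤ Δ) :
    ∃ σ : ℝ, 0 < σ ∧
      (∀ B : ℝ, 0 < B → ∀ ω : InfVolState d (n + 1), IsSourcedGroundStateLimit d n J Δ 2 B ω →
          ∀ x : Site d, σ ≤ latticeStagger x * (ω.expect {x} (siteSpinAt n x 2)).re) ∧
        ∀ ω : InfVolState d (n + 1), IsInfinitesimalFieldGroundState d n J Δ 2 ω →
          ∀ x : Site d, σ ≤ latticeStagger x * (ω.expect {x} (siteSpinAt n x 2)).re := by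
  obtain ⟨σ, hσ, H⟩ := xxzAF_ground_spontaneousNeelMagnetisation_groundStateFunctional hd hn hdn hJ hΔ
  refine ⟨σ, hσ, le_stagMagnetisation_ground_of_eventually fun B hB ε hε => (H B hB ε hε).mono fun k hk => ?_⟩
  rwa [div_eq_inv_mul] at hk

end InfiniteVolume

end XXZKT

end Literature.MathematicalPhysics.QuantumLattice

end
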